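import Summits.ABC.IUTFork.Joshi.ArithTeichmullerFrobenius
import HarnessLib

/-!
# Joshi, *Arithmetic Teichmüller spaces I* (arXiv 2106.11452v4) §5.20–§5.21: the Frobenius of `|𝒴_{F,E}|` READ as the
# Lubin–Tate scalar `π` on `𝒢(𝒪_F)` — (5.20.3) `|𝒳_{F,E}| = (𝒢(𝒪_F) − {0})/E^*`, Thm 5.21.1 (4) well defined for EVERY `σ`,
# unit scalars act trivially, and the TOPOLOGY of `|𝒴_{F,E}|` constructed (Thm 5.21.1 (3): action by homeomorphisms)

Companion of the abc-iut cell, branch E (seat abc-iut-E-t1 gen 3, [J-I] carrier owner; rung LADDER-ABC:A2.E) over this seat's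
BUILT parents `ArithTeichmullerAction` (p429850: `ProjPoints 𝒪E G = (G − {0})/𝒪E^*`, `projAct`, the signature `UntiltPoints`
with `ptEquiv : |𝒴_{F,E}| ≃ (𝒢(𝒪_F) − {0})/𝒪_E^*` = (5.20.2), `ptAct`) and `ArithTeichmullerFrobenius` (p431235: `XPt D =
|𝒴_{F,E}|/φ^ℤ`, `xClass`, the named well-definedness condition `FrobCompatible σ`, `xAct`). It discharges the block-opens
recorded against the carrier by E-t21 (HOME/HANDOFF.md 09:08:36Z: «(a) topology + action on `|𝒴_{F,E}|`», «(b) (5.20.3)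
`|𝒳_{F,E}| = (𝒢(𝒪_F)∖0)/E^×` untyped») and E-t55's «candidate DERIVABLE: Thm 5.21.1 (4) `FrobCompatible` under frob =
`𝒪_E`-scalar» (STATUS 10:58:34Z). TAKES NO SIDE on [IUTchIII] Cor. 3.12 or on any author (Mochizuki / Scholze–Stix / Joshi /
Dupuy–Hilado); typed ≠ proved ≠ endorsed; the one hypothesis is a READING DATUM, never asserted; no test line vs `S` arises here.

Source (UNREFEREED «Preliminary version for comments»; bib `Joshi2021ATS1`; render of record
`HOME/plan/repair/lit/renders/Joshi-ATS1-2106.11452v4-PDFpaged-book-anonnd/`, «p.N l.M»): p.33 l.1 «naturally an `E`-vector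
space (and hence also an `𝒪_E`-module)»; §5.20 p.33 «a canonical identification `|𝒴_{F,E}|/φ^ℤ ≃ |𝒳_{F,E}|` given by
`y ↦ {φⁿ(y) : n ∈ ℤ}`»; proof of Thm 5.20.1, p.33 last line «(5.20.2) `|𝒴_{F,E}| = (𝒢(𝒪_F) − {0})/𝒪_E^*`» and p.34 l.1–6
«(5.20.3) `|𝒳_{F,E}| = (𝒢(𝒪_F) − {0})/E^*` … The topological space `(𝒢(𝒪_F) − {0})` is independent of `E, E′` and the
anabelomorphism … induces isomorphisms of the topological groups `𝒪_E^* ≃ 𝒪_{E′}^*` and `E^* ≃ E′^*`. Hence all the assertions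
are immediate.» [FarguesFontaine2018, Prop 2.1.10, Thm 6.5.2]; Thm 5.21.1 (3) p.34 «a natural action of the group
`Aut_{𝒪_E}(𝒢(𝒪_F))`, of topological automorphisms … on the set of closed points of degree one», (4) p.34 l.28–31
«`{φⁿ(y) : n ∈ ℤ} ↦ {φⁿ(σ(y)) : n ∈ ℤ}`». [claim: Joshi2021ATS1, status: disputed]

WHAT IS TYPED / PROVED (sorry-free, standard axioms).
* §1 `scalarEquiv`, `projAct_scalarEquiv_comm` (every linear automorphism commutes with a scalar on `(G − {0})/𝒪E^*`),
  `projAct_smulOfUnit` (unit scalars act TRIVIALLY on `(G − {0})/𝒪E^*`: the «`𝒪_E^*`» of p.34 l.4 is invisible on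
  `|𝒴_{F,E}|` — kernel fact, recorded without interpretation), `projActPerm`, `zpowRel`, `semiconj_zpow_of_semiconj`.
* §2 `UntiltPoints.FrobScalarDatum D` — READING DATUM of the step (5.20.2) ⟶ (5.20.3) (`E^* = π^ℤ·𝒪_E^*`): a scalar `π ∈ 𝒪E`
  acting bijectively on `𝒢(𝒪_F)` with `φ` = multiplication by `π` along `ptEquiv`. Never asserted/instantiated. DERIVED from
  it: `ptAct_frob`, `frobCompatible_of_frobScalar` (`FrobCompatible σ` for EVERY `σ`: Thm 5.21.1 (4) well defined),
  `xActTotal` (+ `_one`/`_mul`: an ACTION on `|𝒳_{F,E}|`), (5.20.3) `xPtEquiv : |𝒳_{F,E}| ≃ ((𝒢(𝒪_F) − {0})/𝒪_E^*)/π^ℤ`.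
* §3 TOPOLOGY of `|𝒴_{F,E}|` CONSTRUCTED (`projTopology`, `ptTopology`: quotient of the subspace topology of `G − {0}`,
  transported along `ptEquiv`; E-t21's signature `ATS1.PointsTopGal.top`, p433841, posits this datum); `continuous_ptAct`,
  `ptActHomeomorph σ : |𝒴_{F,E}| ≃ₜ |𝒴_{F,E}|` (the continuity of `σ`, idle in p429850, is used here).
Deliberately NOT here: a `G_E`-action on `|𝒴_{F,E}|` (print names only `𝒪_E^*`, `E^*`; through `𝒪_E^*`-scalars it would be
trivial by `projAct_smulOfUnit`); any property of the actual Fargues–Fontaine curve (no such object in the tree).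
-/

noncomputable section

namespace Summit.ABC.IUTFork.Joshi

/-! ## 1. Scalars on `(G − {0})/𝒪E^*`; permutations and `Φ^ℤ`-orbits -/

section Proj

variable {𝒪E : Type} [CommRing 𝒪E] {G : Type} [AddCommGroup G] [Module 𝒪E G]

/-- Multiplication by a scalar `a ∈ 𝒪E` acting BIJECTIVELY on `G` (`G = 𝒢(𝒪_F)` is «naturally an `E`-vector space», p.33 l.1:
e.g. a uniformiser `π`), as an `𝒪E`-linear automorphism. [folklore] -/
def scalarEquiv (a : 𝒪E) (ha : Function.Bijective fun g : G => a • g) : G ≃ₗ[𝒪E] G :=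
  LinearEquiv.ofBijective (LinearMap.lsmul 𝒪E G a) ha

/-- `scalarEquiv a` is multiplication by `a`. [folklore] -/
@[simp] theorem scalarEquiv_apply (a : 𝒪E) (ha : Function.Bijective fun g : G => a • g) (g : G) :
    scalarEquiv a ha g = a • g := rfl

/-- On representatives, `projAct σ ⟦g⟧ = ⟦σ g⟧`. [folklore] -/
theorem projAct_mk (σ : G ≃ₗ[𝒪E] G) (g : {g : G // g ≠ 0}) :
    projAct σ (Quotient.mk'' g : ProjPoints 𝒪E G) = Quotient.mk'' (nonzeroMap σ g) := rfl

/-- **Every `𝒪E`-linear automorphism commutes with a scalar on `(G − {0})/𝒪E^*`** (`σ (a • g) = a • σ g`) — the algebraic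
reason why `Aut_{𝒪_E}(𝒢(𝒪_F))` commutes with `φ` once `φ` is read as the scalar `π`. [folklore] -/
theorem projAct_scalarEquiv_comm (σ : G ≃ₗ[𝒪E] G) (a : 𝒪E) (ha : Function.Bijective fun g : G => a • g)
    (x : ProjPoints 𝒪E G) :
    projAct σ (projAct (scalarEquiv a ha) x) = projAct (scalarEquiv a ha) (projAct σ x) := by
  induction x using Quotient.inductionOn' with
  | h g =>
    rw [projAct_mk, projAct_mk, projAct_mk, projAct_mk]
    congr 1
    apply Subtype.ext
    show σ (a • (g : G)) = a • σ (g : G)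
    exact map_smul σ a (g : G)

/-- **Unit scalars act trivially on `(G − {0})/𝒪E^*`** (`⟦u • g⟧ = ⟦g⟧`, `u ∈ 𝒪E^*`): on (5.20.2) the «`𝒪_E^*`» of p.34 l.4
is invisible. Kernel fact about the quotient, recorded without interpretation. [folklore] -/
theorem projAct_smulOfUnit (u : 𝒪Eˣ) (x : ProjPoints 𝒪E G) : projAct (LinearEquiv.smulOfUnit u) x = x := by
  induction x using Quotient.inductionOn' with
  | h g =>
    rw [projAct_mk]
    apply Quotient.sound
    refine ⟨u⁻¹, ?_⟩
    show u⁻¹ • (LinearEquiv.smulOfUnit u (g : G)) = (g : G)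
    exact inv_smul_smul u (g : G)

/-- Any linear automorphism that is pointwise a unit scalar acts trivially on `(G − {0})/𝒪E^*`. [folklore] -/
theorem projAct_eq_self_of_forall_eq_smul (σ : G ≃ₗ[𝒪E] G) (u : 𝒪Eˣ) (hσ : ∀ g : G, σ g = u • g)
    (x : ProjPoints 𝒪E G) : projAct σ x = x := by
  induction x using Quotient.inductionOn' with
  | h g =>
    rw [projAct_mk]
    apply Quotient.sound
    refine ⟨u⁻¹, ?_⟩
    show u⁻¹ • σ (g : G) = (g : G)
    rw [hσ, inv_smul_smul]

/-- `projAct σ` as a PERMUTATION of `(G − {0})/𝒪E^*` (inverse `projAct σ⁻¹`). [folklore] -/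
def projActPerm (σ : G ≃ₗ[𝒪E] G) : Equiv.Perm (ProjPoints 𝒪E G) where
  toFun := projAct σ
  invFun := projAct σ.symm
  left_inv x := by
    induction x using Quotient.inductionOn' with
    | h g => rw [projAct_mk, projAct_mk]; exact congrArg _ (Subtype.ext (σ.symm_apply_apply (g : G)))
  right_inv x := by
    induction x using Quotient.inductionOn' with
    | h g => rw [projAct_mk, projAct_mk]; exact congrArg _ (Subtype.ext (σ.apply_symm_apply (g : G)))

/-- `projActPerm σ` is `projAct σ`. [folklore] -/
@[simp] theorem projActPerm_apply (σ : G ≃ₗ[𝒪E] G) (x : ProjPoints 𝒪E G) : projActPerm σ x = projAct σ x := rfl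

end Proj

section Orbits

variable {X : Type}

/-- The `Φ^ℤ`-orbit relation of a permutation `Φ`: `x ~ x′` iff `x′ = Φⁿ(x)` for some `n ∈ ℤ` (the shape of
`UntiltPoints.frobRel`). [folklore] -/
def zpowRel (Φ : Equiv.Perm X) : Setoid X where
  r x x' := ∃ n : ℤ, (Φ ^ n) x = x'
  iseqv :=
    { refl := fun x => ⟨0, by simp⟩
      symm := fun {x x'} h => by
        obtain ⟨n, hn⟩ := h
        refine ⟨-n, ?_⟩
        rw [← hn, ← Equiv.Perm.mul_apply, zpow_neg, inv_mul_cancel, Equiv.Perm.one_apply]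
      trans := fun {a b c} h h' => by
        obtain ⟨n, hn⟩ := h
        obtain ⟨m, hm⟩ := h'
        refine ⟨m + n, ?_⟩
        rw [zpow_add, Equiv.Perm.mul_apply, hn, hm] }

/-- A map intertwining two permutations intertwines all their INTEGER powers. [folklore] -/
theorem semiconj_zpow_of_semiconj {Y : Type} (e : X → Y) (φ : Equiv.Perm X) (Φ : Equiv.Perm Y)
    (h : ∀ x, e (φ x) = Φ (e x)) (n : ℤ) (x : X) : e ((φ ^ n) x) = (Φ ^ n) (e x) := by
  have hinv : ∀ x, e (φ.symm x) = Φ.symm (e x) := fun x => by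
    apply Φ.injective
    rw [← h, Equiv.apply_symm_apply, Equiv.apply_symm_apply]
  have powNat : ∀ (k : ℕ) (x : X), e ((φ ^ k) x) = (Φ ^ k) (e x) := by
    intro k
    induction k with
    | zero => intro x; simp
    | succ k ih => intro x; rw [pow_succ', Equiv.Perm.mul_apply, h, ih, pow_succ', Equiv.Perm.mul_apply]
  have powNatInv : ∀ (k : ℕ) (x : X), e ((φ.symm ^ k) x) = (Φ.symm ^ k) (e x) := by
    intro k
    induction k with
    | zero => intro x; simp
    | succ k ih => intro x; rw [pow_succ', Equiv.Perm.mul_apply, hinv, ih, pow_succ', Equiv.Perm.mul_apply]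
  cases n with
  | ofNat k => rw [Int.ofNat_eq_natCast, zpow_natCast, zpow_natCast, powNat]
  | negSucc k =>
    rw [zpow_negSucc, zpow_negSucc, ← inv_pow, ← inv_pow, Equiv.Perm.inv_def, Equiv.Perm.inv_def, powNatInv]

end Orbits

/-! ## 2. The reading datum «`φ` = the Lubin–Tate scalar `π`»: Thm 5.21.1 (4) for every `σ`, and (5.20.3) -/

namespace UntiltPoints

variable {p : ℕ} [Fact p.Prime] {𝒪E : Type} [CommRing 𝒪E] (D : UntiltPoints p 𝒪E)

/-- **READING DATUM «the Frobenius of `|𝒴_{F,E}|` is the Lubin–Tate scalar `π` on `𝒢(𝒪_F)`»** — the content of the step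
(5.20.2) `|𝒴_{F,E}| = (𝒢(𝒪_F) − {0})/𝒪_E^*` ⟶ (5.20.3) `|𝒳_{F,E}| = |𝒴_{F,E}|/φ^ℤ = (𝒢(𝒪_F) − {0})/E^*` (p.33 last line –
p.34 l.2 [FarguesFontaine2018, Prop 2.1.10, Thm 6.5.2]; `E^* = π^ℤ·𝒪_E^*`): a scalar `π ∈ 𝒪E` acting BIJECTIVELY on `𝒢(𝒪_F)`
(«naturally an `E`-vector space», p.33 l.1) such that, along the signature's `ptEquiv` = (5.20.2), `φ` is multiplication by
`π`. Hypothesis-object over `UntiltPoints` (which builds in nothing about the Fargues–Fontaine curve); NEVER asserted or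
instantiated here. [claim: Joshi2021ATS1, status: disputed] -/
@[claim "Joshi2021ATS1" "disputed"]
structure FrobScalarDatum : Type where
  /-- the scalar (a uniformiser `π` of `𝒪_E` in print) -/
  π : 𝒪E
  /-- `π` acts bijectively on `𝒢(𝒪_F)` -/
  bij : Function.Bijective fun g : D.G => π • g
  /-- along (5.20.2), `φ` is multiplication by `π` -/
  frob_eq : ∀ y : D.Pt, D.ptEquiv (D.frob y) = projAct (scalarEquiv π bij) (D.ptEquiv y)

variable {D}

namespace FrobScalarDatum

/-- The scalar automorphism `π • (·)` of `𝒢(𝒪_F)` carried by the datum. [folklore] -/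
def frobG (S : D.FrobScalarDatum) : D.G ≃ₗ[𝒪E] D.G := scalarEquiv S.π S.bij

/-- Along `ptEquiv`, `ptAct σ` is `projAct σ` (unfolding of p429850's transport definition). [folklore] -/
theorem ptEquiv_ptAct (σ : D.Aut) (y : D.Pt) : D.ptEquiv (D.ptAct σ y) = projAct σ.toLinearEquiv (D.ptEquiv y) := by
  simp [UntiltPoints.ptAct]

/-- **Every `σ ∈ Aut_{𝒪_E}(𝒢(𝒪_F))` commutes with the Frobenius of `|𝒴_{F,E}|`** under the reading datum (`σ` is `𝒪E`-linear,
`φ` is the scalar `π`). DERIVED. [folklore] -/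
theorem ptAct_frob (S : D.FrobScalarDatum) (σ : D.Aut) (y : D.Pt) : D.ptAct σ (D.frob y) = D.frob (D.ptAct σ y) := by
  apply D.ptEquiv.injective
  rw [ptEquiv_ptAct, S.frob_eq, S.frob_eq, ptEquiv_ptAct]
  exact projAct_scalarEquiv_comm σ.toLinearEquiv S.π S.bij (D.ptEquiv y)

/-- **Thm 5.21.1 (4) is well defined for EVERY `σ`** under the reading datum: the named condition `FrobCompatible σ` of
p431235 («implicit in print») HOLDS for all `σ ∈ Aut_{𝒪_E}(𝒢(𝒪_F))` — E-t55's «candidate DERIVABLE» (STATUS 10:58:34Z)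
discharged under the typed reading of print's own proof of Thm 5.20.1. DERIVED. [folklore] -/
theorem frobCompatible_of_frobScalar (S : D.FrobScalarDatum) (σ : D.Aut) : D.FrobCompatible σ := fun y => by
  rw [S.ptAct_frob σ y, D.xClass_frob]

/-- **The action of `Aut_{𝒪_E}(𝒢(𝒪_F))` on `|𝒳_{F,E}|`** (Thm 5.21.1 (4) «`{φⁿ(y)} ↦ {φⁿ(σ(y))}`»), DEFINED for every `σ` under
the reading datum (p431235's `xAct` at the derived well-definedness). [claim: Joshi2021ATS1, status: disputed] -/
def xActTotal (S : D.FrobScalarDatum) (σ : D.Aut) : D.XPt → D.XPt := D.xAct σ (S.frobCompatible_of_frobScalar σ)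

/-- The printed recipe: the class of `y` goes to the class of `σ(y)`. [folklore] -/
theorem xActTotal_xClass (S : D.FrobScalarDatum) (σ : D.Aut) (y : D.Pt) :
    S.xActTotal σ (D.xClass y) = D.xClass (D.ptAct σ y) := rfl

/-- The identity acts trivially on `|𝒳_{F,E}|`. [folklore] -/
theorem xActTotal_one (S : D.FrobScalarDatum) (x : D.XPt) : S.xActTotal 1 x = x := by
  obtain ⟨y, rfl⟩ := D.xClass_surjective x
  rw [xActTotal_xClass, D.ptAct_one]

/-- `σ τ` acts on `|𝒳_{F,E}|` as `σ` after `τ`: item (4) is an ACTION of `Aut_{𝒪_E}(𝒢(𝒪_F))`. [folklore] -/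
theorem xActTotal_mul (S : D.FrobScalarDatum) (σ τ : D.Aut) (x : D.XPt) :
    S.xActTotal (σ * τ) x = S.xActTotal σ (S.xActTotal τ x) := by
  obtain ⟨y, rfl⟩ := D.xClass_surjective x
  rw [xActTotal_xClass, xActTotal_xClass, xActTotal_xClass, D.ptAct_mul]

/-- **(5.20.3) `|𝒳_{F,E}| = (𝒢(𝒪_F) − {0})/E^*`, DERIVED from (5.20.2) and the reading datum**: `XPt D = |𝒴_{F,E}|/φ^ℤ` is
in canonical bijection with the `π^ℤ`-orbit quotient of `(𝒢(𝒪_F) − {0})/𝒪_E^*`, i.e. with `(𝒢(𝒪_F) − {0})/(π^ℤ·𝒪_E^*) =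
(𝒢(𝒪_F) − {0})/E^*` (p.34 l.1–2), the class of `y` going to the class of `ptEquiv y`. [claim: Joshi2021ATS1, status: disputed] -/
def xPtEquiv (S : D.FrobScalarDatum) : D.XPt ≃ Quotient (zpowRel (projActPerm S.frobG)) :=
  Quotient.congr D.ptEquiv fun y y' => by
    show (∃ n : ℤ, (D.frob ^ n) y = y') ↔ ∃ n : ℤ, (projActPerm S.frobG ^ n) (D.ptEquiv y) = D.ptEquiv y'
    have key : ∀ (n : ℤ) (z : D.Pt), D.ptEquiv ((D.frob ^ n) z) = (projActPerm S.frobG ^ n) (D.ptEquiv z) :=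
      fun n z => semiconj_zpow_of_semiconj D.ptEquiv D.frob (projActPerm S.frobG) (fun w => S.frob_eq w) n z
    constructor
    · rintro ⟨n, rfl⟩
      exact ⟨n, (key n y).symm⟩
    · rintro ⟨n, hn⟩
      refine ⟨n, D.ptEquiv.injective ?_⟩
      rw [key n y, hn]

/-- On classes: `xPtEquiv ⟦y⟧ = ⟦ptEquiv y⟧`. [folklore] -/
theorem xPtEquiv_xClass (S : D.FrobScalarDatum) (y : D.Pt) :
    S.xPtEquiv (D.xClass y) = Quotient.mk (zpowRel (projActPerm S.frobG)) (D.ptEquiv y) := rfl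

/-- A unit-scalar automorphism (pointwise `u • (·)`, `u ∈ 𝒪_E^*`) fixes EVERY point of `|𝒴_{F,E}|` (cf. `projAct_smulOfUnit`;
needs no datum): the `𝒪_E^*` of p.34 l.4 acts trivially on (5.20.2). Kernel fact, not interpreted. [folklore] -/
theorem ptAct_eq_self_of_forall_eq_smul (σ : D.Aut) (u : 𝒪Eˣ) (hσ : ∀ g : D.G, σ g = u • g) (y : D.Pt) :
    D.ptAct σ y = y := by
  apply D.ptEquiv.injective
  rw [ptEquiv_ptAct]
  exact projAct_eq_self_of_forall_eq_smul σ.toLinearEquiv u hσ (D.ptEquiv y)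

end FrobScalarDatum

end UntiltPoints

/-! ## 3. The topology of `|𝒴_{F,E}|` (constructed) and the action by homeomorphisms (Thm 5.21.1 (3)) -/

section Topology

variable {𝒪E : Type} [CommRing 𝒪E] {G : Type} [AddCommGroup G] [Module 𝒪E G] [TopologicalSpace G]

/-- The topology of `(G − {0})/𝒪E^*`: the QUOTIENT topology of the subspace topology of `G − {0} ⊆ G` («the topological space
`(𝒢(𝒪_F) − {0})`», p.34 l.3). A reducible `def`, not an instance. [folklore] -/
@[reducible] def projTopology : TopologicalSpace (ProjPoints 𝒪E G) :=
  @instTopologicalSpaceQuotient {g : G // g ≠ 0} (unitRel 𝒪E G) inferInstance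

/-- A CONTINUOUS linear automorphism acts continuously on `(G − {0})/𝒪E^*`. [folklore] -/
theorem continuous_projAct (σ : G ≃L[𝒪E] G) :
    @Continuous _ _ projTopology projTopology (projAct (𝒪E := 𝒪E) (G := G) σ.toLinearEquiv) := by
  letI : TopologicalSpace (ProjPoints 𝒪E G) := projTopology
  have hc : Continuous (nonzeroMap (𝒪E := 𝒪E) (G := G) σ.toLinearEquiv) :=
    (σ.continuous.comp continuous_subtype_val).subtype_mk _
  exact hc.quotient_map' _

end Topology

namespace UntiltPoints

variable {p : ℕ} [Fact p.Prime] {𝒪E : Type} [CommRing 𝒪E] (D : UntiltPoints p 𝒪E)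

/-- **The topology of `|𝒴_{F,E}|`, CONSTRUCTED** from the signature: the quotient topology of `(𝒢(𝒪_F) − {0})/𝒪_E^*`
transported along (5.20.2) = `ptEquiv` (Thm 5.20.1 «homeomorphism of topological spaces … `|𝒴_{F,E}|`», p.33 l.36, read
through its proof p.34 l.3). Supplies canonically the datum `ATS1.PointsTopGal.top` that E-t21's signature (p433841) posits.
A reducible `def`, not an instance. [claim: Joshi2021ATS1, status: disputed] -/
@[reducible] def ptTopology : TopologicalSpace D.Pt := TopologicalSpace.induced D.ptEquiv projTopology

/-- (5.20.2) is a homeomorphism for the constructed topology (by construction). [folklore] -/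
def ptEquivHomeomorph : @Homeomorph D.Pt (ProjPoints 𝒪E D.G) D.ptTopology projTopology :=
  letI : TopologicalSpace (ProjPoints 𝒪E D.G) := projTopology
  letI : TopologicalSpace D.Pt := D.ptTopology
  { D.ptEquiv with
    continuous_toFun := continuous_induced_dom
    continuous_invFun := by
      have h : @Continuous _ _ projTopology (TopologicalSpace.induced D.ptEquiv projTopology) D.ptEquiv.symm := by
        rw [continuous_induced_rng]
        have hc : (D.ptEquiv ∘ D.ptEquiv.symm : ProjPoints 𝒪E D.G → ProjPoints 𝒪E D.G) = id := by
          funext x; simp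
        rw [hc]
        exact continuous_id
      exact h }

/-- **Thm 5.21.1 (3): the «topological automorphisms» act CONTINUOUSLY on `|𝒴_{F,E}|`** for the constructed topology (the
continuity of `σ ∈ Aut_{𝒪_E}(𝒢(𝒪_F))`, idle in p429850's `ptAct`, is used here). DERIVED. [folklore] -/
theorem continuous_ptAct (σ : D.Aut) : @Continuous _ _ D.ptTopology D.ptTopology (D.ptAct σ) := by
  letI : TopologicalSpace (ProjPoints 𝒪E D.G) := projTopology
  letI : TopologicalSpace D.Pt := D.ptTopology
  have h : D.ptAct σ = D.ptEquivHomeomorph.symm ∘ projAct σ.toLinearEquiv ∘ D.ptEquivHomeomorph := by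
    funext y; rfl
  rw [h]
  exact D.ptEquivHomeomorph.symm.continuous.comp ((continuous_projAct σ).comp D.ptEquivHomeomorph.continuous)

/-- **`Aut_{𝒪_E}(𝒢(𝒪_F))` acts on `|𝒴_{F,E}|` by HOMEOMORPHISMS** (inverse `ptAct σ⁻¹`). DERIVED. [folklore] -/
def ptActHomeomorph (σ : D.Aut) : @Homeomorph D.Pt D.Pt D.ptTopology D.ptTopology :=
  letI : TopologicalSpace D.Pt := D.ptTopology
  { toFun := D.ptAct σ
    invFun := D.ptAct σ⁻¹
    left_inv := fun y => by rw [← D.ptAct_mul, inv_mul_cancel, D.ptAct_one]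
    right_inv := fun y => by rw [← D.ptAct_mul, mul_inv_cancel, D.ptAct_one]
    continuous_toFun := D.continuous_ptAct σ
    continuous_invFun := D.continuous_ptAct σ⁻¹ }

/-- `ptActHomeomorph σ` is `ptAct σ`. [folklore] -/
theorem ptActHomeomorph_apply (σ : D.Aut) (y : D.Pt) : D.ptActHomeomorph σ y = D.ptAct σ y := rfl

end UntiltPoints

end Summit.ABC.IUTFork.Joshi

end
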